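import Mathlib.RingTheory.Regular.RegularSequence
import Mathlib.RingTheory.Depth.Rees
import Mathlib.RingTheory.Ideal.AssociatedPrime.Localization
import Mathlib.RingTheory.Filtration
import Mathlib.RingTheory.Ideal.KrullsHeightTheorem
import Mathlib.RingTheory.Ideal.Height
import Mathlib.RingTheory.KrullDimension.Basic
import Mathlib.RingTheory.Spectrum.Prime.Basic
import Mathlib.Order.KrullDimension
import HarnessLib

/-!
# Regular sequences of length `dim R`: unmixedness and cutting down (Cohen–Macaulay local rings)

Topic: `Literature/AlgebraicGeometry/Resolution`. Mathlib (this pin) has regular sequences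
(`RingTheory.Sequence.IsRegular`), associated primes, Artin–Rees and Rees' theorem
(`ModuleCat.exists_isRegular_tfae`), but no Cohen–Macaulay theory. This file proves, for a
Noetherian local ring `(R, 𝔪)` and without introducing a Cohen–Macaulay predicate, exactly the
part of that theory needed to show that Cohen–Macaulay (in particular regular, in particular
complete regular) local rings are catenary (`CohenMacaulayCatenary.lean`, for Stacks 032C /
`Stacks07QW_complete`): "`R` has an `R`-regular sequence in `𝔪` of length `dim R`" is used
verbatim as the Cohen–Macaulay hypothesis. Everything is PROVED; no named facts.

## Content (namespace `Literature.AlgebraicGeometry.Resolution`)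

* `exists_mem_associatedPrimes_quotSMulTop_pow` — **Stacks 0CN5**: `𝔭 ∈ Ass M`, `𝔮` minimal over
  `𝔭 + (x)` ⇒ `𝔮 ∈ Ass(M/xⁿM)` for some `n ≥ 1` (Artin–Rees).
* `isRegular_cons_pow` — `x, x₂, … ` regular ⇒ `xⁿ, x₂, …` regular (Matsumura Thm. 16.1).
* `not_mem_of_isSMulRegular` — `M`-regular elements avoid the associated primes of `M`.
* `length_le_coheight_of_mem_associatedPrimes` — **Stacks 0BK4** for regular sequences: an
  `M`-regular sequence in `𝔪` has length `≤ dim R/𝔭` for every `𝔭 ∈ Ass M`.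
* `minimalPrimes_of_mem_associatedPrimes` — **unmixedness (Stacks 0BUS, `M = R`)**: if `R` has a
  regular sequence in `𝔪` of length `dim R` then `Ass R` consists of minimal primes.
* `exists_isRegular_quotSMulTop` — **cutting down (Stacks 00N6 for `M = R`, via Rees)**: with such
  a sequence of length `d` and a non-zero-divisor `y ∈ 𝔪`, the `R`-module `R/yR` carries a
  regular sequence in `𝔪` of length `d - 1`; `isRegular_quotient_of_isRegular_quotSMulTop`,
  `map_mem_associatedPrimes_quotient`, `mk_mem_maximalIdeal_quotient`,
  `isLocalRing_quotient_span_singleton` transfer regular sequences and associated primes from the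
  `R`-module `R/yR` to the local ring `R/yR`.
* `height_add_coheight_le_krullDim` — order-theoretic helper.

## Sources

* The Stacks Project, Algebra: Tags 0CN5, 0BK4 (Section 00LE "Depth"), 00N6, 0BUS
  (Section 00N2 "Cohen–Macaulay modules"). [StacksProject]
* H. Matsumura, *Commutative Ring Theory*, CUP 1986: Thm. 16.1 (powers/permutations of regular
  sequences), Thm. 16.7 (Rees: depth via `Ext`), Thm. 17.2 (`depth M ≤ dim A/𝔭`), Thm. 17.3,
  Thm. 17.4 [PDF 150]. [Matsumura1987]
-/

noncomputable section

open IsLocalRing RingTheory.Sequence Submodule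
open scoped Pointwise

namespace Literature.AlgebraicGeometry.Resolution

universe u v

section Inherit

variable {R : Type u} [CommRing R] [IsNoetherianRing R]
variable {M : Type v} [AddCommGroup M] [Module R M] [Module.Finite R M]

/-- **Stacks 0CN5**: let `𝔭 ∈ Ass(M)` (`M` finite over the Noetherian ring `R`), `x ∈ R` and `𝔮`
a prime minimal over `𝔭 + (x)`. Then `𝔮 ∈ Ass(M/xⁿM)` for some `n ≥ 1`. (Printed proof: pick
`N ⊆ M` with `N ≅ R/𝔭`; by Artin–Rees `N ∩ xⁿM ⊆ xN` for some `n`; the image `N̄` of `N` in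
`M/xⁿM` surjects onto `N/xN = R/(𝔭 + (x))`, so `𝔮 ∈ Supp(N̄)`, and `N̄` is killed by `𝔭` and
`xⁿ`, so `𝔮` is minimal in `Supp(N̄)`, hence associated.) [cite: StacksProject, Tag 0CN5] -/
theorem exists_mem_associatedPrimes_quotSMulTop_pow {p : Ideal R}
    (hp : p ∈ associatedPrimes R M) (x : R) {q : Ideal R}
    (hq : q ∈ (p ⊔ Ideal.span {x}).minimalPrimes) :
    ∃ n : ℕ, 0 < n ∧ q ∈ associatedPrimes R (QuotSMulTop (x ^ n) M) := by
  classical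
  obtain ⟨hpprime, f, hf⟩ := (isAssociatedPrime_iff_exists_injective_linearMap p M).mp hp
  set N : Submodule R M := LinearMap.range f with hN
  set I : Ideal R := Ideal.span {x} with hI
  -- Artin–Rees
  obtain ⟨k, hk⟩ := Ideal.exists_pow_inf_eq_pow_smul I N
  set n := k + 1 with hn
  have hAR : ∀ m ∈ N, m ∈ (x ^ n • ⊤ : Submodule R M) → m ∈ x • N := by
    intro m hmN hmx
    have h1 : m ∈ I ^ n • ⊤ ⊓ N := by
      refine ⟨?_, hmN⟩
      rw [hI, Ideal.span_singleton_pow, ideal_span_singleton_smul]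
      exact hmx
    rw [hk n (Nat.le_succ k), hn, Nat.add_sub_cancel_left, pow_one] at h1
    have h2 : I • (I ^ k • ⊤ ⊓ N) ≤ I • N := smul_mono_right _ inf_le_right
    have h3 := h2 h1
    rwa [hI, ideal_span_singleton_smul] at h3
  refine ⟨n, Nat.succ_pos k, ?_⟩
  -- the image of `N` in `M / xⁿ M`
  set Q := QuotSMulTop (x ^ n) M with hQ
  set π : M →ₗ[R] Q := (x ^ n • (⊤ : Submodule R M)).mkQ with hπ
  set Nbar : Submodule R Q := N.map π with hNbar
  -- (a) `Ann(N̄) ⊆ 𝔭 + (x)`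
  set e : M := f (Ideal.Quotient.mk p 1) with he
  have heN : e ∈ N := LinearMap.mem_range_self f _
  have hann_le : Module.annihilator R Nbar ≤ p ⊔ I := by
    intro r hr
    rw [Module.mem_annihilator] at hr
    have h1 : r • (⟨π e, mem_map_of_mem heN⟩ : Nbar) = 0 := hr _
    have h2 : r • π e = 0 := congrArg Subtype.val h1
    rw [← map_smul, hπ, mkQ_apply, Quotient.mk_eq_zero] at h2
    have h3 := hAR (r • e) (N.smul_mem r heN) h2
    rw [mem_smul_pointwise_iff_exists] at h3
    obtain ⟨b, hbN, hb⟩ := h3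
    obtain ⟨t, rfl⟩ := LinearMap.mem_range.mp hbN
    obtain ⟨t₀, rfl⟩ := Ideal.Quotient.mk_surjective t
    rw [he] at hb
    have hb' : f (x • Ideal.Quotient.mk p t₀) = f (r • Ideal.Quotient.mk p 1) := by
      rw [map_smul, map_smul]
      exact hb
    have h4 := hf hb'
    simp only [Algebra.smul_def, Ideal.Quotient.algebraMap_eq, ← map_mul, mul_one] at h4
    have h5 : x * t₀ - r ∈ p := Ideal.Quotient.eq.mp h4
    have h6 : x * t₀ - (x * t₀ - r) ∈ p ⊔ I :=
      Ideal.sub_mem _ (Ideal.mem_sup_right (I.mul_mem_right t₀ (Ideal.mem_span_singleton_self x)))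
        (Ideal.mem_sup_left h5)
    rwa [sub_sub_cancel] at h6
  -- (b) `𝔭 ⊆ Ann(N̄)` and `xⁿ ∈ Ann(N̄)`
  have hp_le : p ≤ Module.annihilator R Nbar := by
    intro a ha
    rw [Module.mem_annihilator]
    rintro ⟨z, hz⟩
    obtain ⟨m', hm'N, rfl⟩ := mem_map.mp hz
    obtain ⟨t, rfl⟩ := LinearMap.mem_range.mp hm'N
    obtain ⟨t₀, rfl⟩ := Ideal.Quotient.mk_surjective t
    refine Subtype.ext ?_
    show a • π (f (Ideal.Quotient.mk p t₀)) = 0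
    rw [← map_smul, ← map_smul, Algebra.smul_def, Ideal.Quotient.algebraMap_eq, ← map_mul,
      Ideal.Quotient.eq_zero_iff_mem.mpr (p.mul_mem_right t₀ ha), map_zero, map_zero]
  have hxn : x ^ n ∈ Module.annihilator R Nbar := by
    rw [Module.mem_annihilator]
    rintro ⟨z, hz⟩
    refine Subtype.ext ?_
    show x ^ n • z = 0
    exact Module.mem_annihilator.mp (QuotSMulTop.mem_annihilator M (x ^ n)) z
  -- (c) `𝔮` is minimal over `Ann(N̄)`, hence associated to `N̄ ⊆ M/xⁿM`
  have hmin : q ∈ (Module.annihilator R Nbar).minimalPrimes := by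
    refine ⟨⟨hq.1.1, hann_le.trans hq.1.2⟩, fun q' hq' hq'q => hq.2 ⟨hq'.1, sup_le ?_ ?_⟩ hq'q⟩
    · exact hp_le.trans hq'.2
    · have hxq' : x ∈ q' := hq'.1.mem_of_pow_mem n (hq'.2 hxn)
      exact (Ideal.span_singleton_le_iff_mem _).mpr hxq'
  have h1 : q ∈ associatedPrimes R Nbar :=
    Module.associatedPrimes.minimalPrimes_annihilator_subset_associatedPrimes R Nbar hmin
  exact associatedPrimes.subset_of_injective Nbar.injective_subtype h1

end Inherit

/-! ## Powers in regular sequences; the unmixedness inequality (Stacks 0BK4 for regular sequences) -/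

section Unmixed

variable {R : Type u} [CommRing R] [IsLocalRing R] [IsNoetherianRing R]

/-- In a Noetherian local ring, if `x, x₂, …, x_r ∈ 𝔪` is an `M`-regular sequence then so is
`xⁿ, x₂, …, x_r` (`n ≥ 1`): move `x` to the end (regular sequences in `𝔪` permute), replace it by
`xⁿ` (a power of an injective endomorphism is injective), and move it back.
[cite: Matsumura1987, Thm. 16.1 and Cor. to Thm. 16.3] -/
theorem isRegular_cons_pow {M : Type v} [AddCommGroup M] [Module R M] [Module.Finite R M]
    {x : R} {rs : List R} (h : IsRegular M (x :: rs))
    (hmem : ∀ r ∈ x :: rs, r ∈ maximalIdeal R) {n : ℕ} (hn : 0 < n) :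
    IsRegular M (x ^ n :: rs) := by
  haveI := h.nontrivial
  have h1 : IsRegular M (rs ++ [x]) :=
    IsLocalRing.isRegular_of_perm h (List.perm_append_singleton x rs).symm
  have h2 := (isWeaklyRegular_append_iff M rs [x]).mp h1.toIsWeaklyRegular
  have h3 : IsWeaklyRegular (M ⧸ (Ideal.ofList rs • ⊤ : Submodule R M)) [x ^ n] :=
    (isWeaklyRegular_singleton_iff _ _).mpr
      (((isWeaklyRegular_singleton_iff _ _).mp h2.2).pow n)
  have h4 : IsWeaklyRegular M (rs ++ [x ^ n]) := (isWeaklyRegular_append_iff M rs [x ^ n]).mpr ⟨h2.1, h3⟩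
  have hmem' : ∀ r ∈ rs ++ [x ^ n], r ∈ maximalIdeal R := by
    intro r hr
    rcases List.mem_append.mp hr with hr | hr
    · exact hmem r (List.mem_cons_of_mem x hr)
    · rw [List.mem_singleton.mp hr]
      exact Ideal.pow_mem_of_mem _ (hmem x List.mem_cons_self) n hn
  have h5 : IsRegular M (rs ++ [x ^ n]) :=
    IsRegular.of_isWeaklyRegular_of_mem_maximalIdeal M hmem' h4
  exact IsLocalRing.isRegular_of_perm h5 (List.perm_append_singleton (x ^ n) rs)

omit [IsLocalRing R] in
/-- An element of an associated prime of `M` is not `M`-regular (it kills a non-zero element).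
[folklore] -/
theorem not_mem_of_isSMulRegular {M : Type v} [AddCommGroup M] [Module R M] {p : Ideal R}
    (hp : p ∈ associatedPrimes R M) {x : R} (hx : IsSMulRegular M x) : x ∉ p := by
  intro hxp
  obtain ⟨hpprime, m, hm⟩ := isAssociatedPrime_iff.mp hp
  have hm0 : m ≠ 0 := by
    rintro rfl
    apply hpprime.ne_top
    rw [hm, Submodule.colon_singleton_zero]
  have h1 : x • m = 0 := by
    rw [hm, Submodule.mem_colon_singleton, Submodule.mem_bot] at hxp
    exact hxp
  exact hm0 (hx.right_eq_zero_of_smul h1)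

/-- **Stacks 0BK4 for regular sequences** (the unmixedness inequality): if `M` is a finite
module over the Noetherian local ring `(R, 𝔪)` admitting an `M`-regular sequence in `𝔪` of
length `r`, then `dim R/𝔭 ≥ r` for every associated prime `𝔭` of `M` (here `dim R/𝔭` is the
coheight of `𝔭` in `Spec R`). Printed proof (with `depth M` for `r`): induction on `r`; for
`x` the first element, `x ∉ 𝔭`; a prime `𝔮` minimal over `𝔭 + (x)` is associated to `M/xⁿM`
for some `n` (Stacks 0CN5), which carries the regular sequence `x₂, …, x_r`; hence
`dim R/𝔭 > dim R/𝔮 ≥ r - 1`. [cite: StacksProject, Tag 0BK4] -/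
theorem length_le_coheight_of_mem_associatedPrimes {M : Type v} [AddCommGroup M] [Module R M]
    [Module.Finite R M] {rs : List R} (hrs : IsRegular M rs)
    (hmem : ∀ r ∈ rs, r ∈ maximalIdeal R) {p : Ideal R} (hp : p ∈ associatedPrimes R M) :
    (rs.length : ℕ∞) ≤ Order.coheight (⟨p, IsAssociatedPrime.isPrime hp⟩ : PrimeSpectrum R) := by
  induction rs generalizing M p with
  | nil => simp
  | cons x rs ih =>
    obtain ⟨hx, -⟩ := (isRegular_cons_iff M x rs).mp hrs
    have hpprime : p.IsPrime := IsAssociatedPrime.isPrime hp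
    have hxp : x ∉ p := not_mem_of_isSMulRegular hp hx
    -- a prime minimal over `𝔭 + (x)` inside `𝔪`
    have hle : p ⊔ Ideal.span {x} ≤ maximalIdeal R :=
      sup_le (IsLocalRing.le_maximalIdeal hpprime.ne_top)
        ((Ideal.span_singleton_le_iff_mem _).mpr (hmem x List.mem_cons_self))
    obtain ⟨q, hq, -⟩ := Ideal.exists_minimalPrimes_le hle
    obtain ⟨n, hn, hqass⟩ := exists_mem_associatedPrimes_quotSMulTop_pow hp x hq
    -- `xⁿ, x₂, …` is regular, so `x₂, …` is regular on `M/xⁿM`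
    have hrs' : IsRegular (QuotSMulTop (x ^ n) M) rs :=
      ((isRegular_cons_iff M (x ^ n) rs).mp (isRegular_cons_pow hrs hmem hn)).2
    have ih' := ih hrs' (fun r hr => hmem r (List.mem_cons_of_mem x hr)) hqass
    -- `𝔭 < 𝔮`
    have hpq : (⟨p, hpprime⟩ : PrimeSpectrum R) < ⟨q, hq.1.1⟩ := by
      refine lt_of_le_of_ne (show p ≤ q from le_sup_left.trans hq.1.2) fun h => hxp ?_
      have hxq : x ∈ q := hq.1.2 (Ideal.mem_sup_right (Ideal.mem_span_singleton_self x))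
      have := congrArg PrimeSpectrum.asIdeal h
      simp only at this
      rwa [← this] at hxq
    have h2 := Order.coheight_add_one_le hpq
    calc ((x :: rs).length : ℕ∞) = rs.length + 1 := by simp
      _ ≤ Order.coheight (⟨q, hq.1.1⟩ : PrimeSpectrum R) + 1 := add_le_add ih' le_rfl
      _ ≤ _ := h2

/-- The height plus the coheight of a point is at most the Krull dimension. [folklore] -/
theorem height_add_coheight_le_krullDim {α : Type*} [Preorder α] (a : α) :
    ((Order.height a + Order.coheight a : ℕ∞) : WithBot ℕ∞) ≤ Order.krullDim α := by
  haveI : Nonempty α := ⟨a⟩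
  rw [Order.krullDim_eq_iSup_height_add_coheight_of_nonempty, WithBot.coe_le_coe]
  exact le_iSup (fun a => Order.height a + Order.coheight a) a

/-- **Unmixedness** (Macaulay, Cohen; Stacks 0BUS for `M = R`): if the Noetherian local ring
`R` admits a regular sequence in `𝔪` of length `dim R`, then every associated prime of `R` is
a minimal prime — `R` has no embedded primes. [cite: StacksProject, Tag 0BUS] -/
theorem minimalPrimes_of_mem_associatedPrimes {rs : List R} (hrs : IsRegular R rs)
    (hmem : ∀ r ∈ rs, r ∈ maximalIdeal R) (hlen : (rs.length : WithBot ℕ∞) = ringKrullDim R)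
    {p : Ideal R} (hp : p ∈ associatedPrimes R R) : p ∈ minimalPrimes R := by
  have hpprime : p.IsPrime := IsAssociatedPrime.isPrime hp
  set P : PrimeSpectrum R := ⟨p, hpprime⟩ with hP
  have h1 := length_le_coheight_of_mem_associatedPrimes hrs hmem hp
  have h2 := height_add_coheight_le_krullDim P
  rw [← ringKrullDim, ← hlen, ← WithBot.coe_natCast, WithBot.coe_le_coe] at h2
  -- `coheight P` is finite (bounded by `dim R = rs.length`)
  have h3 : Order.coheight P ≤ rs.length := le_trans (le_add_self) h2
  obtain ⟨c, hc⟩ := ENat.ne_top_iff_exists.mp (ne_top_of_le_ne_top (ENat.coe_ne_top _) h3)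
  rw [← hc] at h1 h2 h3
  obtain ⟨h, hh⟩ := ENat.ne_top_iff_exists.mp
    (ne_top_of_le_ne_top (ENat.coe_ne_top _) ((le_self_add).trans h2) : Order.height P ≠ ⊤)
  rw [← hh] at h2
  have h4 : h + c ≤ rs.length := by exact_mod_cast h2
  have h5 : rs.length ≤ c := by exact_mod_cast h1
  have h6 : h = 0 := by omega
  show P.asIdeal ∈ minimalPrimes R
  rw [← PrimeSpectrum.isMin_iff]
  rw [h6, Nat.cast_zero] at hh
  exact Order.height_eq_zero.mp hh.symm

end Unmixed

/-! ## Cutting down by a non-zero-divisor (Rees) -/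

section Rees

variable {R : Type u} [CommRing R] [IsLocalRing R] [IsNoetherianRing R]

open CategoryTheory CategoryTheory.Abelian in
/-- **A maximal regular sequence can be started with any non-zero-divisor** (the case `M = R` of
Stacks 00N6 via Rees' theorem, Matsumura Thm. 16.7 / Stacks 090R as formalised in Mathlib): if the
Noetherian local ring `(R, 𝔪)` has a regular sequence in `𝔪` of length `d` and `y ∈ 𝔪` is a
non-zero-divisor, then `R/yR` has an `R`-regular sequence in `𝔪` of length `d - 1`. Proof:
`Extⁱ(k', R) = 0` for `i < d` (`k' = R/𝔪`), so the long exact sequence of `0 → R → R → R/yR → 0`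
gives `Extⁱ(k', R/yR) = 0` for `i < d - 1`, and Rees' theorem converts this back into a regular
sequence. [cite: Matsumura1987, Thm. 16.7 and Thm. 17.4 (iii)] -/
theorem exists_isRegular_quotSMulTop {rs : List R} (hrs : IsRegular R rs)
    (hmem : ∀ r ∈ rs, r ∈ maximalIdeal R) {y : R} (hy : IsSMulRegular R y)
    (hym : y ∈ maximalIdeal R) :
    ∃ rs' : List R, rs'.length = rs.length - 1 ∧ (∀ r ∈ rs', r ∈ maximalIdeal R) ∧
      IsRegular (QuotSMulTop y R) rs' := by
  set I := maximalIdeal R with hI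
  let M : ModuleCat.{u} R := ModuleCat.of R R
  have smul_lt : I • (⊤ : Submodule R M) < ⊤ :=
    lt_top_iff_ne_top.mpr
      (top_ne_ideal_smul_of_le_jacobson_annihilator (maximalIdeal_le_jacobson _)).symm
  have hex : ∃ rs' : List R, rs'.length = rs.length ∧ (∀ r ∈ rs', r ∈ I) ∧ IsRegular M rs' :=
    ⟨rs, rfl, hmem, hrs⟩
  have hM : ∀ i < rs.length,
      Subsingleton (Ext (ModuleCat.of R (Shrink.{u} (R ⧸ I))) M i) :=
    ((ModuleCat.exists_isRegular_tfae I rs.length M smul_lt).out 3 1).mp hex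
  have hy' : IsSMulRegular M y := hy
  haveI : Nontrivial (QuotSMulTop y R) := nontrivial_quotSMulTop_of_mem_maximalIdeal R hym
  have smul_ltQ : I • (⊤ : Submodule R (ModuleCat.of R (QuotSMulTop y R))) < ⊤ :=
    lt_top_iff_ne_top.mpr
      (top_ne_ideal_smul_of_le_jacobson_annihilator (maximalIdeal_le_jacobson _)).symm
  have hQ : ∀ i < rs.length - 1,
      Subsingleton (Ext (ModuleCat.of R (Shrink.{u} (R ⧸ I))) (ModuleCat.of R (QuotSMulTop y R)) i) := by
    intro i hi
    have zero1 := AddCommGrpCat.isZero_of_iff_subsingleton.mpr (hM i (by omega))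
    have zero2 := AddCommGrpCat.isZero_of_iff_subsingleton.mpr (hM (i + 1) (by omega))
    exact AddCommGrpCat.subsingleton_of_isZero <| ShortComplex.Exact.isZero_of_both_zeros
      ((Ext.covariant_sequence_exact₃' (ModuleCat.of R (Shrink.{u} (R ⧸ I)))
        hy'.smulShortComplex_shortExact) i (i + 1) rfl)
      (zero1.eq_zero_of_src _) (zero2.eq_zero_of_tgt _)
  exact ((ModuleCat.exists_isRegular_tfae I (rs.length - 1) (ModuleCat.of R (QuotSMulTop y R))
    smul_ltQ).out 1 3).mp hQ

omit [IsNoetherianRing R] in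
/-- For `y, r ∈ 𝔪`, the class of `r` lies in the maximal ideal of `R/yR`. [folklore] -/
theorem mk_mem_maximalIdeal_quotient {y : R} (hy : y ∈ maximalIdeal R)
    [IsLocalRing (R ⧸ Ideal.span {y})] {r : R} (hr : r ∈ maximalIdeal R) :
    Ideal.Quotient.mk (Ideal.span {y}) r ∈ maximalIdeal (R ⧸ Ideal.span {y}) := by
  rw [IsLocalRing.mem_maximalIdeal, mem_nonunits_iff]
  intro hu
  obtain ⟨s, hs⟩ := hu.exists_right_inv
  obtain ⟨s₀, rfl⟩ := Ideal.Quotient.mk_surjective s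
  rw [← map_mul, ← (Ideal.Quotient.mk (Ideal.span {y})).map_one, Ideal.Quotient.eq,
    Ideal.mem_span_singleton'] at hs
  obtain ⟨a, ha⟩ := hs
  apply (maximalIdeal.isMaximal R).ne_top
  rw [Ideal.eq_top_iff_one]
  have h1 : r * s₀ - a * y ∈ maximalIdeal R :=
    Ideal.sub_mem _ (Ideal.mul_mem_right _ _ hr) (Ideal.mul_mem_left _ _ hy)
  rwa [ha, sub_sub_cancel] at h1

omit [IsNoetherianRing R] in
/-- `R/yR` for `y ∈ 𝔪` is a (nontrivial) local ring. [folklore] -/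
theorem isLocalRing_quotient_span_singleton {y : R} (hy : y ∈ maximalIdeal R) :
    Nontrivial (R ⧸ Ideal.span {y}) ∧ IsLocalRing (R ⧸ Ideal.span {y}) := by
  have hne : Ideal.span {y} ≠ ⊤ := fun h =>
    (maximalIdeal.isMaximal R).ne_top (top_le_iff.mp (h ▸ (Ideal.span_singleton_le_iff_mem _).mpr hy))
  haveI : Nontrivial (R ⧸ Ideal.span {y}) := Ideal.Quotient.nontrivial_iff.mpr hne
  exact ⟨‹_›, IsLocalRing.of_surjective' (Ideal.Quotient.mk _) Ideal.Quotient.mk_surjective⟩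

omit [IsNoetherianRing R] in
/-- Transfer of a regular sequence from the `R`-module `R/yR` to the ring `R/yR`.
[folklore] -/
theorem isRegular_quotient_of_isRegular_quotSMulTop {y : R} (hy : y ∈ maximalIdeal R)
    {rs : List R} (h : IsRegular (QuotSMulTop y R) rs) (hmem : ∀ r ∈ rs, r ∈ maximalIdeal R) :
    haveI := (isLocalRing_quotient_span_singleton hy).2
    (∀ r ∈ rs.map (Ideal.Quotient.mk (Ideal.span {y})), r ∈ maximalIdeal (R ⧸ Ideal.span {y})) ∧
    IsRegular (R ⧸ Ideal.span {y}) (rs.map (Ideal.Quotient.mk (Ideal.span {y}))) := by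
  obtain ⟨hnt, hloc⟩ := isLocalRing_quotient_span_singleton hy
  have heq : (y • (⊤ : Submodule R R)) = Ideal.span {y} := by
    rw [← ideal_span_singleton_smul, smul_eq_mul, Ideal.mul_top]
  let e : QuotSMulTop y R ≃ₗ[R] (R ⧸ Ideal.span {y}) := Submodule.quotEquivOfEq _ _ heq
  have h1 : IsRegular (R ⧸ Ideal.span {y}) rs := (e.isRegular_congr rs).mp h
  have h2 : IsWeaklyRegular (R ⧸ Ideal.span {y}) (rs.map (Ideal.Quotient.mk (Ideal.span {y}))) := by
    rw [← Ideal.Quotient.algebraMap_eq]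
    exact (isWeaklyRegular_map_algebraMap_iff (R ⧸ Ideal.span {y}) (R ⧸ Ideal.span {y}) rs).mpr
      h1.toIsWeaklyRegular
  have hmem' : ∀ r ∈ rs.map (Ideal.Quotient.mk (Ideal.span {y})),
      r ∈ maximalIdeal (R ⧸ Ideal.span {y}) := by
    intro r hr
    obtain ⟨r₀, hr₀, rfl⟩ := List.mem_map.mp hr
    exact mk_mem_maximalIdeal_quotient hy (hmem r₀ hr₀)
  exact ⟨hmem', IsRegular.of_isWeaklyRegular_of_mem_maximalIdeal (R ⧸ Ideal.span {y}) hmem' h2⟩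

omit [IsLocalRing R] in
/-- Associated primes of the `R`-module `R/yR` map to associated primes of the ring `R/yR`
(as a module over itself). [folklore] -/
theorem map_mem_associatedPrimes_quotient {y : R} {p : Ideal R}
    (hp : p ∈ associatedPrimes R (QuotSMulTop y R)) :
    p.map (Ideal.Quotient.mk (Ideal.span {y})) ∈
      associatedPrimes (R ⧸ Ideal.span {y}) (R ⧸ Ideal.span {y}) := by
  have heq : (y • (⊤ : Submodule R R)) = Ideal.span {y} := by
    rw [← ideal_span_singleton_smul, smul_eq_mul, Ideal.mul_top]
  let e : QuotSMulTop y R ≃ₗ[R] (R ⧸ Ideal.span {y}) := Submodule.quotEquivOfEq _ _ heq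
  have hp' : p ∈ associatedPrimes R (R ⧸ Ideal.span {y}) := by
    rw [← LinearEquiv.AssociatedPrimes.eq e]
    exact hp
  obtain ⟨hpprime, z, hz⟩ := isAssociatedPrime_iff.mp hp'
  set mk := Ideal.Quotient.mk (Ideal.span {y}) with hmk
  -- `y ∈ 𝔭` (it kills everything), so `𝔭 ⊇ ker`
  have hker : Ideal.span {y} ≤ p := by
    rw [Ideal.span_singleton_le_iff_mem, hz, Submodule.mem_colon_singleton, Submodule.mem_bot,
      Algebra.smul_def, Ideal.Quotient.algebraMap_eq,
      Ideal.Quotient.eq_zero_iff_mem.mpr (Ideal.mem_span_singleton_self y), zero_mul]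
  have hprime : (p.map mk).IsPrime :=
    Ideal.map_isPrime_of_surjective Ideal.Quotient.mk_surjective (by rw [Ideal.mk_ker]; exact hker)
  refine isAssociatedPrime_iff.mpr ⟨hprime, z, ?_⟩
  ext w
  obtain ⟨r, rfl⟩ := Ideal.Quotient.mk_surjective w
  rw [hmk, Ideal.mem_quotient_iff_mem hker, Submodule.mem_colon_singleton, Submodule.mem_bot, hz,
    Submodule.mem_colon_singleton, Submodule.mem_bot, Algebra.smul_def,
    Ideal.Quotient.algebraMap_eq, smul_eq_mul]

end Rees

end Literature.AlgebraicGeometry.Resolution
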